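import Literature.MathematicalPhysics.QuantumLattice.ClusterProductStateEnergy
import Literature.MathematicalPhysics.QuantumLattice.HubbardTTPrimeBoxHamiltonian
import Literature.MathematicalPhysics.QuantumLattice.HubbardNNNHoppingLocalHamiltonian
import Literature.MathematicalPhysics.QuantumLattice.FermionRelabelling
import Literature.MathematicalPhysics.QuantumLattice.InfVolFermionStateSpinFlip
import Literature.MathematicalPhysics.QuantumLattice.HubbardWave0RepulsiveProofs
import Literature.MathematicalPhysics.QuantumLattice.HubbardOpenBoxWitnessPlanes
import HarnessLib

/-!
# The free-boundary `t–t'–t''` box Hamiltonian of the square lattice: graph form of the third-neighbour part, the open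
# `a × b` cluster Hamiltonian `hubbardOpenBoxTT'T''`, and the coordinate relabelling `[0,q+1) ≃ Fin (q₀+1) ×ₗ Fin (q₁+1)`

Topic `Literature/MathematicalPhysics/QuantumLattice` (family `hubbard`; §1–§2 general `d`, §3–§4 `ℤ²`). The `t''` twin of
`HubbardTTPrimeBoxHamiltonian.lean` (`H^{tt'}_Λ = hamiltonian (polyGraph Λ) t U + hamiltonian G' t' 0`; on `[0,ℓ)²` the sector energies are
those of `hubbardOpenBoxTT' ℓ ℓ`), written for the t″-EXACT object-M cluster caps of the Hubbard material-oracle programme (cell hubbard-fast,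
seat hubbard-box-p3 g15; companion of `ClusterProductStateEnergy.lean`): the kernel-checked cluster certificates (`HubbardOpenBoxEDUpperCertificate*`,
hubbard-box-p2) evaluate quadratic forms of EXPLICIT operators on `Fock (Orb (Fin a ×ₗ Fin b))`, so the free-boundary local Hamiltonian
`Σ_{X ⊆ [0,q+1)} Φ^M(X)` of the `t–t'–t''` interaction must be identified with such an operator.

* §1 `ite_axial2Adj_eq_sum`, `sum_powerset_eq_of_axial2_support` (axial twins of the diagonal bookkeeping lemmas) and
  **`axialRange2Hopping_localHamiltonian_eq_hamiltonian`**: `Σ_{X ⊆ Λ} Φ''^{t''}(X) = hamiltonian G'' t'' 0` for every graph `G''` on the sites of `Λ`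
  realising the third-neighbour adjacency `b = a ± 2e_i`.
* §2 **`hubbardTT'T''_localHamiltonian_eq_threeGraph`**: `H^{M}_Λ = hamiltonian (polyGraph Λ) t U + hamiltonian G' t' 0 + hamiltonian G'' t'' 0`.
* §3 the open-cluster objects on `Fin a ×ₗ Fin b`: `line2Adj`, **`rectBoxAxial2Graph a b`** (bonds `|Δx| = 2, Δy = 0` or `Δx = 0, |Δy| = 2` inside the box),
  **`hubbardOpenBoxTT'T'' a b t t' t'' U := hubbardOpenBoxTT' a b t t' U + hamiltonian (rectBoxAxial2Graph a b) t'' 0`** (LeBlanc et al. eq. (1) +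
  Pavarini's `t''` on an open cluster), affine in `t''`.
* §4 the rectangle `[0,q+1) ⊆ ℤ²`: the coordinate bijection `exists_equiv_polySite_halfOpenRect_two`, the three adjacency transfers, and
  **`relabel_symm_hubbardOpenBoxTT'T''_eq_localHamiltonian`**: `Γ_{f⁻¹}(hubbardOpenBoxTT'T'' (q₀+1) (q₁+1) t t' t'' U) = H^M_{[0,q+1)}` — so
  `tr(H^M_{[0,q+1)} · Γ_{f⁻¹} ρ) = tr(hubbardOpenBoxTT'T'' · ρ)` for every cluster density matrix `ρ` (`trace_localHamiltonian_mul_relabel_symm`).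
* §5 **`tiGroundEnergyDensityAt_hubbardTT'T''_le_rayleigh_openBox`**: for every unit `N`-particle cluster vector `φ`,
  `e^M_{N/|C|}(t,t',t'',U; R ≥ 2) ≤ Re⟨φ, hubbardOpenBoxTT'T'' φ⟩/|C|` (the pulled-back projector `Γ_{f⁻¹}|φ⟩⟨φ|` is an even density matrix on the
  rectangle; `ClusterProductStateEnergy.tiGroundEnergyDensityAt_hubbardTT'T''_le_of_rectTilingState`).
* §6 **`tiGroundEnergyDensityAt_hubbardTT'T''_le_of_openBox_witness_planes`**: five form bounds (nearest `E_K`, diagonal `E_P/E_M`, third-neighbour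
  `E₃P/E₃M`, docc `E_D`) on ONE vector ⇒ `e^M(1,t',t'',U; N/|C|) ≤ (E_K + max(t'E_P, −t'E_M) + max(t''E₃P, −t''E₃M) + U E_D)/|C|` for all `t', t''`,
  `U ≥ 0` — the shape a kernel certificate (`HubbardOpenBoxEDUpperCertificate*`) discharges with ONE extra form (the third-neighbour hop sum).

Everything is PROVED; definitions with bodies (`line2Adj`, `rectBoxAxial2Graph`, `hubbardOpenBoxTT'T''`), no named fact, no number, no `sorry`.

## Tree / Mathlib search

REUSED: `ite_diagAdj_eq_sum` / `sum_powerset_eq_of_diag_support` / `diagHoppingFermionInteraction_localHamiltonian_eq_hamiltonian` (cloned for `axial2Vec`);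
`axial2Vec(_injective/_ne_zero)`, `self_ne_add_axial2Vec`, `add_axial2Vec_add_axial2Vec_ne_self`, `axialRange2HoppingFermionInteraction(_apply_pair/_apply_eq_zero)`
(`HubbardThirdNeighbourHoppingInteraction`); `hubbardTTPrime_localHamiltonian_eq_twoGraph`, `exists_equiv_polySite_halfOpenBox_two` (pattern), `rectBoxGraph`,
`rectBoxDiagGraph`, `hubbardOpenBoxTT'`, `lineAdj`; `FermionInteraction.localHamiltonian_eq_sum/_of_add`, `sum_attach_ite_eq`; `relabel(_hamiltonian)`, `trace_relabel`,
`Orb.mapEquiv`; `halfOpenRect`, `mem_halfOpenRect` (`FermionRectTilingProductState`). `rg 'Axial2Graph|OpenBoxTT.T..' --decl`: nothing.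

## References

* E. Pavarini, I. Dasgupta, T. Saha-Dasgupta, O. Jepsen, O. K. Andersen, PRL 87 (2001) 047003, eq. (1). [cite: PavariniEtAl2001, eq. (1)]
* J. P. F. LeBlanc et al., PRX 5 (2015) 041041, eq. (1) (open clusters). [cite: LeBlancEtAl2015, eq. (1)]
* D. Ruelle, *Statistical Mechanics: Rigorous Results* (1969), §3.3. [cite: Ruelle1969, §3.3]
-/

noncomputable section

namespace Literature.MathematicalPhysics.QuantumLattice

open Matrix Finset HubbardWave0 Literature.Probability.LatticeModels ThermodynamicLimit
open scoped ComplexOrder BigOperators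

/-! ### §1. The third-neighbour local Hamiltonian is a graph Hamiltonian -/

section Axial

variable {d : ℕ} (t'' : ℝ)

/-- Axial range-2 adjacency in `ℤ^d` (`y = x ± 2e_i`), as an indicator, splits over the `d` axial directions:
`[x ~ y] T = Σ_i ([y = x + 2e_i] T + [x = y + 2e_i] T)` (at most one of the `2d` conditions holds) — the axial twin of
`ite_diagAdj_eq_sum`. [cite: PavariniEtAl2001, eq. (1)] -/
theorem ite_axial2Adj_eq_sum {M : Type*} [AddCommMonoid M] (x y : Site d) (T : M) :
    (if ((∃ s : Fin d, y = x + axial2Vec s) ∨ ∃ s : Fin d, x = y + axial2Vec s) then T else 0) =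
      ∑ s : Fin d, ((if y = x + axial2Vec s then T else 0) + (if x = y + axial2Vec s then T else 0)) := by
  classical
  by_cases h : (∃ s : Fin d, y = x + axial2Vec s) ∨ ∃ s : Fin d, x = y + axial2Vec s
  · rw [if_pos h]
    rcases h with ⟨s, hs⟩ | ⟨s, hs⟩
    · rw [Finset.sum_eq_single s]
      · subst hs
        rw [if_pos rfl, if_neg (add_axial2Vec_add_axial2Vec_ne_self x s s).symm, add_zero]
      · intro s' _ hs's
        subst hs
        rw [if_neg, if_neg (add_axial2Vec_add_axial2Vec_ne_self x s s').symm, add_zero]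
        intro h'
        exact hs's (axial2Vec_injective (add_left_cancel h')).symm
      · intro hs'
        exact absurd (mem_univ s) hs'
    · rw [Finset.sum_eq_single s]
      · subst hs
        rw [if_neg (add_axial2Vec_add_axial2Vec_ne_self y s s).symm, if_pos rfl, zero_add]
      · intro s' _ hs's
        subst hs
        rw [if_neg (add_axial2Vec_add_axial2Vec_ne_self y s s').symm, if_neg, add_zero]
        intro h'
        exact hs's (axial2Vec_injective (add_left_cancel h')).symm
      · intro hs'
        exact absurd (mem_univ s) hs'
  · rw [if_neg h]
    refine (Finset.sum_eq_zero fun s _ => ?_).symm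
    rw [if_neg, if_neg, add_zero]
    · exact fun h' => h (Or.inr ⟨s, h'⟩)
    · exact fun h' => h (Or.inl ⟨s, h'⟩)

/-- **Support of the axial range-2 interaction inside a region.** If `F : Finset (Site d) → M` vanishes on every `X`
which is not an axial range-2 pair `{x, x + 2e_i}`, then `Σ_{X ⊆ Λ} F X = Σ_{x ∈ Λ, i : x + 2e_i ∈ Λ} F {x, x + 2e_i}` (axial twin of
`sum_powerset_eq_of_diag_support`). [cite: ArakiMoriya2003, §5.1] -/
theorem sum_powerset_eq_of_axial2_support {M : Type*} [AddCommMonoid M] (Λ : Finset (Site d))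
    (F : Finset (Site d) → M)
    (hF : ∀ X : Finset (Site d), (∀ (x : Site d) (s : Fin d), X ≠ {x, x + axial2Vec s}) → F X = 0) :
    ∑ X ∈ Λ.powerset, F X =
      ∑ p ∈ (Λ ×ˢ (univ : Finset (Fin d))) with p.1 + axial2Vec p.2 ∈ Λ, F {p.1, p.1 + axial2Vec p.2} := by
  classical
  set P : Finset (Site d × Fin d) := (Λ ×ˢ (univ : Finset (Fin d))).filter fun p => p.1 + axial2Vec p.2 ∈ Λ
    with hP
  set S' : Finset (Finset (Site d)) := P.image fun p => ({p.1, p.1 + axial2Vec p.2} : Finset (Site d)) with hS'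
  have hS'sub : S' ⊆ Λ.powerset := by
    intro X hX
    rw [hS', mem_image] at hX
    rw [mem_powerset]
    obtain ⟨p, hp, rfl⟩ := hX
    rw [hP, mem_filter, mem_product] at hp
    exact insert_subset hp.1.1 (singleton_subset_iff.2 hp.2)
  have hzero : ∀ X ∈ Λ.powerset, X ∉ S' → F X = 0 := by
    intro X hX hXS
    rw [mem_powerset] at hX
    refine hF X (fun x s hx => hXS ?_)
    rw [hS', mem_image]
    refine ⟨(x, s), ?_, hx.symm⟩
    rw [hP, mem_filter, mem_product]
    exact ⟨⟨hX (hx ▸ mem_insert_self _ _), mem_univ _⟩, hX (hx ▸ mem_insert_of_mem (mem_singleton_self _))⟩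
  rw [← Finset.sum_subset hS'sub hzero]
  have hinj : Set.InjOn (fun p : Site d × Fin d => ({p.1, p.1 + axial2Vec p.2} : Finset (Site d))) ↑P := by
    rintro ⟨x, s⟩ - ⟨y, s'⟩ - h
    dsimp only at h
    have hx : x ∈ ({y, y + axial2Vec s'} : Finset (Site d)) := h ▸ mem_insert_self _ _
    have hxs : x + axial2Vec s ∈ ({y, y + axial2Vec s'} : Finset (Site d)) := h ▸ mem_insert_of_mem (mem_singleton_self _)
    rw [mem_insert, mem_singleton] at hx hxs
    rcases hx with rfl | rfl
    · rcases hxs with h' | h'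
      · exact absurd h' (self_ne_add_axial2Vec x s).symm
      · rw [Prod.mk.injEq]
        exact ⟨rfl, axial2Vec_injective (add_left_cancel h')⟩
    · rcases hxs with h' | h'
      · exact absurd h' (add_axial2Vec_add_axial2Vec_ne_self y s' s)
      · exact absurd (add_eq_left.1 h') (axial2Vec_ne_zero s)
  rw [hS', Finset.sum_image hinj]

/-- **The local Hamiltonian of the axial range-2 hopping interaction is the hopping Hamiltonian of the induced third-neighbour
graph**: if `G'` is a graph on the sites of `Λ ⊆ ℤ^d` with `a ∼ b` iff `b = a ± 2e_i`, then `Σ_{X ⊆ Λ} Φ''^{t''}(X) = hamiltonian G' t'' 0`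
(hopping `t''` along every third-neighbour bond inside `Λ`, no on-site term) — the `t''` twin of
`diagHoppingFermionInteraction_localHamiltonian_eq_hamiltonian`. [cite: PavariniEtAl2001, eq. (1)] -/
theorem axialRange2Hopping_localHamiltonian_eq_hamiltonian (Λ : Finset (Site d))
    (G' : SimpleGraph (PolySite Λ)) [DecidableRel G'.Adj]
    (hG' : ∀ a b : PolySite Λ, G'.Adj a b ↔
      ((∃ s : Fin d, ofLex b.1 = ofLex a.1 + axial2Vec s) ∨ ∃ s : Fin d, ofLex a.1 = ofLex b.1 + axial2Vec s)) :
    (axialRange2HoppingFermionInteraction d t'').localHamiltonian Λ = hamiltonian G' t'' 0 := by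
  classical
  set hop : {x // x ∈ Λ} → {x // x ∈ Λ} → FermionOp Λ := fun x y =>
    ∑ σ : Fin 2, creation (orb (PolySite.pt x.1 x.2) σ) * annihilation (orb (PolySite.pt y.1 y.2) σ) with hhop
  -- (1) the graph Hamiltonian over `Λ.attach` (the on-site term has coefficient `U = 0`)
  have hR : hamiltonian G' t'' 0 =
      -(t'' : ℂ) • ∑ x ∈ Λ.attach, ∑ y ∈ Λ.attach,
        (if ((∃ s : Fin d, y.1 = x.1 + axial2Vec s) ∨ ∃ s : Fin d, x.1 = y.1 + axial2Vec s) then hop x y else 0) := by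
    let e : PolySite Λ ≃ {x // x ∈ Λ} :=
      ⟨fun a => ⟨ofLex a.1, PolySite.ofLex_mem a⟩, fun x => PolySite.pt x.1 x.2, fun a => PolySite.pt_ofLex a,
        fun x => Subtype.ext rfl⟩
    have hsum : ∀ (f : PolySite Λ → FermionOp Λ), ∑ a, f a = ∑ x ∈ Λ.attach, f (PolySite.pt x.1 x.2) := by
      intro f
      rw [← Finset.univ_eq_attach]
      exact Fintype.sum_equiv e f (fun x => f (PolySite.pt x.1 x.2)) fun a => by
        rw [show PolySite.pt (e a).1 (e a).2 = e.symm (e a) from rfl, Equiv.symm_apply_apply]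
    rw [hamiltonian, hsum, hsum, Complex.ofReal_zero, zero_smul, add_zero]
    congr 1
    refine Finset.sum_congr rfl fun x _ => ?_
    rw [hsum]
    refine Finset.sum_congr rfl fun y _ => ?_
    have hadj : G'.Adj (PolySite.pt x.1 x.2) (PolySite.pt y.1 y.2) ↔
        ((∃ s : Fin d, y.1 = x.1 + axial2Vec s) ∨ ∃ s : Fin d, x.1 = y.1 + axial2Vec s) := by
      rw [hG', PolySite.ofLex_coe_pt, PolySite.ofLex_coe_pt]
    by_cases h : (∃ s : Fin d, y.1 = x.1 + axial2Vec s) ∨ ∃ s : Fin d, x.1 = y.1 + axial2Vec s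
    · rw [if_pos h]
      exact Finset.sum_congr rfl fun σ _ => if_pos (hadj.2 h)
    · rw [if_neg h]
      exact Finset.sum_eq_zero fun σ _ => if_neg fun h' => h (hadj.1 h')
  -- (2) the hopping double sum as a sum over the diagonal bonds of `Λ`
  have hhopsum : ∑ x ∈ Λ.attach, ∑ y ∈ Λ.attach,
      (if ((∃ s : Fin d, y.1 = x.1 + axial2Vec s) ∨ ∃ s : Fin d, x.1 = y.1 + axial2Vec s) then hop x y else 0) =
      ∑ s : Fin d, ∑ x ∈ Λ.attach,
        if h : x.1 + axial2Vec s ∈ Λ then hop x ⟨x.1 + axial2Vec s, h⟩ + hop ⟨x.1 + axial2Vec s, h⟩ x else 0 := by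
    simp_rw [ite_axial2Adj_eq_sum]
    have hswap : ∀ x : {x // x ∈ Λ},
        ∑ y ∈ Λ.attach, ∑ s : Fin d, ((if y.1 = x.1 + axial2Vec s then hop x y else 0) +
            (if x.1 = y.1 + axial2Vec s then hop x y else 0)) =
          ∑ s : Fin d, ∑ y ∈ Λ.attach, ((if y.1 = x.1 + axial2Vec s then hop x y else 0) +
            (if x.1 = y.1 + axial2Vec s then hop x y else 0)) := fun x => Finset.sum_comm
    simp_rw [hswap]
    rw [Finset.sum_comm]
    refine Finset.sum_congr rfl fun s _ => ?_
    simp only [Finset.sum_add_distrib]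
    have h1 : ∀ x : {x // x ∈ Λ}, ∑ y ∈ Λ.attach, (if y.1 = x.1 + axial2Vec s then hop x y else 0) =
        if h : x.1 + axial2Vec s ∈ Λ then hop x ⟨x.1 + axial2Vec s, h⟩ else 0 := fun x =>
      sum_attach_ite_eq Λ (x.1 + axial2Vec s) (fun y => hop x y)
    have h2 : ∑ x ∈ Λ.attach, ∑ y ∈ Λ.attach, (if x.1 = y.1 + axial2Vec s then hop x y else 0) =
        ∑ y ∈ Λ.attach, if h : y.1 + axial2Vec s ∈ Λ then hop ⟨y.1 + axial2Vec s, h⟩ y else 0 := by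
      rw [Finset.sum_comm]
      exact Finset.sum_congr rfl fun y _ => sum_attach_ite_eq Λ (y.1 + axial2Vec s) (fun x => hop x y)
    simp_rw [h1]
    rw [h2, ← Finset.sum_add_distrib]
    refine Finset.sum_congr rfl fun x _ => ?_
    by_cases h : x.1 + axial2Vec s ∈ Λ
    · rw [dif_pos h, dif_pos h, dif_pos h]
    · rw [dif_neg h, dif_neg h, dif_neg h, add_zero]
  -- (3) the local Hamiltonian over diagonal bonds
  rw [FermionInteraction.localHamiltonian_eq_sum,
    sum_powerset_eq_of_axial2_support Λ _ (fun X hX => by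
      by_cases h : X ⊆ Λ
      · rw [dif_pos h, axialRange2HoppingFermionInteraction_apply_eq_zero t'' hX, map_zero]
      · rw [dif_neg h]),
    hR, hhopsum]
  rw [Finset.sum_filter, Finset.sum_product, ← Finset.sum_attach Λ, Finset.sum_comm, Finset.smul_sum]
  refine Finset.sum_congr rfl fun s _ => ?_
  rw [Finset.smul_sum]
  refine Finset.sum_congr rfl fun x _ => ?_
  by_cases h : x.1 + axial2Vec s ∈ Λ
  · have hsub : ({x.1, x.1 + axial2Vec s} : Finset (Site d)) ⊆ Λ := insert_subset x.2 (singleton_subset_iff.2 h)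
    rw [if_pos h, dif_pos h, dif_pos hsub, axialRange2HoppingFermionInteraction_apply_pair, fermionEmbed_smul,
      fermionEmbed_sum, hhop]
    simp only [← Finset.sum_add_distrib]
    congr 1
    refine Finset.sum_congr rfl fun σ _ => ?_
    rw [fermionEmbed_add, fermionEmbed_mul, fermionEmbed_mul, fermionEmbed_conjTranspose,
      fermionEmbed_conjTranspose, fermionEmbed_incl_cAt, fermionEmbed_incl_cAt, cAt, cAt,
      annihilation_conjTranspose, annihilation_conjTranspose]
  · rw [if_neg h, dif_neg h, smul_zero]

end Axial

/-! ### §2. The `t–t'–t''` local Hamiltonian is a three-graph Hubbard Hamiltonian -/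

section Three

variable (t t' t'' U : ℝ)

/-- The local Hamiltonians of the `t–t'–t''` interaction: `H^{M}_Λ = H^{tt'}_Λ + H^{t''}_Λ`. [cite: ArakiMoriya2003, §5.1 (local Hamiltonian H(I))] -/
theorem hubbardTT'T''FermionInteraction_localHamiltonian (Λ : Finset (Site 2)) :
    (hubbardTT'T''FermionInteraction t t' t'' U).localHamiltonian Λ =
      (hubbardTTPrimeFermionInteraction t t' U).localHamiltonian Λ + (axialRange2HoppingFermionInteraction 2 t'').localHamiltonian Λ :=
  FermionInteraction.localHamiltonian_of_add (hubbardTT'T''FermionInteraction_apply t t' t'' U) Λ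

/-- **The `t–t'–t''` local Hamiltonian is a three-graph Hubbard Hamiltonian**:
`H^{M}_Λ = hamiltonian (polyGraph Λ) t U + hamiltonian G' t' 0 + hamiltonian G'' t'' 0` for every graph `G'` realising the diagonal adjacency and
every `G''` realising the third-neighbour adjacency on the sites of `Λ`. [cite: PavariniEtAl2001, eq. (1)] [cite: LeBlancEtAl2015, eq. (1)] -/
theorem hubbardTT'T''_localHamiltonian_eq_threeGraph (Λ : Finset (Site 2))
    (G' : SimpleGraph (PolySite Λ)) [DecidableRel G'.Adj]
    (hG' : ∀ a b : PolySite Λ, G'.Adj a b ↔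
      ((∃ s : Fin 2, ofLex b.1 = ofLex a.1 + diagVec s) ∨ ∃ s : Fin 2, ofLex a.1 = ofLex b.1 + diagVec s))
    (G'' : SimpleGraph (PolySite Λ)) [DecidableRel G''.Adj]
    (hG'' : ∀ a b : PolySite Λ, G''.Adj a b ↔
      ((∃ s : Fin 2, ofLex b.1 = ofLex a.1 + axial2Vec s) ∨ ∃ s : Fin 2, ofLex a.1 = ofLex b.1 + axial2Vec s)) :
    (hubbardTT'T''FermionInteraction t t' t'' U).localHamiltonian Λ =
      hamiltonian (polyGraph Λ) t U + hamiltonian G' t' 0 + hamiltonian G'' t'' 0 := by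
  rw [hubbardTT'T''FermionInteraction_localHamiltonian, hubbardTTPrime_localHamiltonian_eq_twoGraph t' t U Λ G' hG',
    axialRange2Hopping_localHamiltonian_eq_hamiltonian t'' Λ G'' hG'']

end Three

/-! ### §3. The open `a × b` cluster: third-neighbour bonds and the `t–t'–t''` cluster Hamiltonian -/

section OpenBox

/-- Range-2 adjacency on a line of naturals: `|u − v| = 2` (the third-neighbour bonds of an open chain). [cite: PavariniEtAl2001, eq. (1)] -/
def line2Adj (u v : ℕ) : Prop := u + 2 = v ∨ v + 2 = u

/-- Range-2 line adjacency is decidable. [cite: PavariniEtAl2001, eq. (1)] -/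
instance instDecidableLine2Adj (u v : ℕ) : Decidable (line2Adj u v) := inferInstanceAs (Decidable (u + 2 = v ∨ v + 2 = u))

/-- The **third-neighbour (axial range-2) bonds** `(|Δx|, |Δy|) ∈ {(2,0), (0,2)}` of the open rectangular cluster `[0, a) × [0, b)`.
[cite: PavariniEtAl2001, eq. (1)] -/
def rectBoxAxial2Graph (a b : ℕ) : SimpleGraph (Fin a ×ₗ Fin b) where
  Adj p q := ((ofLex p).2 = (ofLex q).2 ∧ line2Adj (ofLex p).1 (ofLex q).1) ∨
    ((ofLex p).1 = (ofLex q).1 ∧ line2Adj (ofLex p).2 (ofLex q).2)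
  symm := ⟨fun p q h => by
    rcases h with ⟨h1, h2⟩ | ⟨h1, h2⟩
    · exact Or.inl ⟨h1.symm, h2.symm⟩
    · exact Or.inr ⟨h1.symm, h2.symm⟩⟩
  loopless := ⟨fun p h => by
    rcases h with ⟨-, h2⟩ | ⟨-, h2⟩ <;> · rcases h2 with h2 | h2 <;> omega⟩

/-- Open-box third-neighbour adjacency is decidable. [cite: PavariniEtAl2001, eq. (1)] -/
instance instDecidableRelRectBoxAxial2GraphAdj (a b : ℕ) : DecidableRel (rectBoxAxial2Graph a b).Adj :=
  fun p q => inferInstanceAs (Decidable (((ofLex p).2 = (ofLex q).2 ∧ line2Adj (ofLex p).1 (ofLex q).1) ∨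
    ((ofLex p).1 = (ofLex q).1 ∧ line2Adj (ofLex p).2 (ofLex q).2)))

/-- The **`t–t'–t''` Hubbard Hamiltonian of the open `a × b` cluster** (free boundary conditions):
`H = hubbardOpenBoxTT' a b t t' U − t'' Σ_{third-neighbour bonds ⊂ box, σ} c†_{xσ}c_{yσ}` — Pavarini's one-band model truncated after `t''`, on an open
cluster. [cite: PavariniEtAl2001, eq. (1)] [cite: LeBlancEtAl2015, eq. (1)] -/
def hubbardOpenBoxTT'T'' (a b : ℕ) (t t' t'' U : ℝ) :
    Matrix (Finset (Orb (Fin a ×ₗ Fin b))) (Finset (Orb (Fin a ×ₗ Fin b))) ℂ :=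
  hubbardOpenBoxTT' a b t t' U + hamiltonian (rectBoxAxial2Graph a b) t'' 0

/-- Unfolding. [cite: PavariniEtAl2001, eq. (1)] -/
theorem hubbardOpenBoxTT'T''_def (a b : ℕ) (t t' t'' U : ℝ) :
    hubbardOpenBoxTT'T'' a b t t' t'' U = hubbardOpenBoxTT' a b t t' U + hamiltonian (rectBoxAxial2Graph a b) t'' 0 := rfl

/-- At `t'' = 0` the `t–t'–t''` cluster Hamiltonian is the `t–t'` one. [cite: LeBlancEtAl2015, eq. (1)] -/
theorem hubbardOpenBoxTT'T''_zero (a b : ℕ) (t t' U : ℝ) :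
    hubbardOpenBoxTT'T'' a b t t' 0 U = hubbardOpenBoxTT' a b t t' U := by
  rw [hubbardOpenBoxTT'T'', hamiltonian]
  simp

end OpenBox

/-! ### §4. The rectangle `[0,q+1) ⊆ ℤ²` relabelled onto the open cluster -/

section Rect

variable (q : Fin 2 → ℕ)

/-- Coordinates of the sites of `[0,q+1)` are in `[0, q_i+1)`. [cite: ArakiMoriya2003, §4.1 Def. 4.3] -/
theorem coord_mem_of_polySite_halfOpenRect (a : PolySite (halfOpenRect q)) (i : Fin 2) :
    0 ≤ ofLex a.1 i ∧ ofLex a.1 i < (q i : ℤ) + 1 :=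
  (mem_halfOpenRect.1 (PolySite.ofLex_mem a)) i

/-- **The sites of the rectangle `[0,q₀+1) × [0,q₁+1) ⊆ ℤ²` are those of the open cluster `Fin (q₀+1) ×ₗ Fin (q₁+1)`**: there is a
site bijection reading off the two coordinates (rectangular twin of `exists_equiv_polySite_halfOpenBox_two`). [cite: LeBlancEtAl2015, eq. (1)] -/
theorem exists_equiv_polySite_halfOpenRect_two :
    ∃ f : PolySite (halfOpenRect q) ≃ Fin (q 0 + 1) ×ₗ Fin (q 1 + 1),
      (∀ a, (((ofLex (f a)).1 : ℕ) : ℤ) = ofLex a.1 0) ∧ (∀ a, (((ofLex (f a)).2 : ℕ) : ℤ) = ofLex a.1 1) := by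
  have hlt : ∀ (a : PolySite (halfOpenRect q)) (i : Fin 2), (ofLex a.1 i).toNat < q i + 1 := fun a i => by
    have h := coord_mem_of_polySite_halfOpenRect q a i
    omega
  set g : PolySite (halfOpenRect q) → Fin (q 0 + 1) ×ₗ Fin (q 1 + 1) := fun a =>
    toLex (⟨(ofLex a.1 0).toNat, hlt a 0⟩, ⟨(ofLex a.1 1).toNat, hlt a 1⟩) with hg
  have hg0 : ∀ a, (((ofLex (g a)).1 : ℕ) : ℤ) = ofLex a.1 0 := fun a => by
    have h := (coord_mem_of_polySite_halfOpenRect q a 0).1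
    simp only [hg, ofLex_toLex]
    omega
  have hg1 : ∀ a, (((ofLex (g a)).2 : ℕ) : ℤ) = ofLex a.1 1 := fun a => by
    have h := (coord_mem_of_polySite_halfOpenRect q a 1).1
    simp only [hg, ofLex_toLex]
    omega
  have hinj : Function.Injective g := by
    intro a b h
    have h0 : ofLex a.1 0 = ofLex b.1 0 := by rw [← hg0 a, ← hg0 b, h]
    have h1 : ofLex a.1 1 = ofLex b.1 1 := by rw [← hg1 a, ← hg1 b, h]
    have : ofLex a.1 = ofLex b.1 := by
      funext i
      rcases fin_two_eq_zero_or_one i with rfl | rfl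
      · exact h0
      · exact h1
    exact Subtype.ext (ofLex.injective this)
  have hsurj : Function.Surjective g := by
    intro p
    set x : Site 2 := ![(((ofLex p).1 : ℕ) : ℤ), (((ofLex p).2 : ℕ) : ℤ)] with hx
    have hx0 : x 0 = ((ofLex p).1 : ℕ) := rfl
    have hx1 : x 1 = ((ofLex p).2 : ℕ) := rfl
    have hxmem : x ∈ halfOpenRect q := by
      rw [mem_halfOpenRect]
      intro i
      rcases fin_two_eq_zero_or_one i with rfl | rfl
      · rw [hx0]
        exact ⟨Nat.cast_nonneg _, by exact_mod_cast (ofLex p).1.isLt⟩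
      · rw [hx1]
        exact ⟨Nat.cast_nonneg _, by exact_mod_cast (ofLex p).2.isLt⟩
    refine ⟨PolySite.pt x hxmem, ?_⟩
    refine ofLex.injective (Prod.ext (Fin.ext ?_) (Fin.ext ?_))
    · have h := hg0 (PolySite.pt x hxmem)
      rw [PolySite.ofLex_coe_pt, hx0, Nat.cast_inj] at h
      exact h
    · have h := hg1 (PolySite.pt x hxmem)
      rw [PolySite.ofLex_coe_pt, hx1, Nat.cast_inj] at h
      exact h
  exact ⟨Equiv.ofBijective g ⟨hinj, hsurj⟩, hg0, hg1⟩

/-- Equality of sites of `ℤ²` is equality of both coordinates. [folklore] -/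
private theorem site_two_eq_iff (x y : Site 2) : x = y ↔ x 0 = y 0 ∧ x 1 = y 1 := by
  refine ⟨fun h => ⟨by rw [h], by rw [h]⟩, fun h => funext fun i => ?_⟩
  rcases fin_two_eq_zero_or_one i with rfl | rfl
  exacts [h.1, h.2]

/-- Nearest-neighbour adjacency of `ℤ²` in coordinates. [folklore] -/
private theorem zdGraph_two_adj_iff (x y : Site 2) : (zdGraph 2).Adj x y ↔
    ((y 0 = x 0 + 1 ∧ y 1 = x 1) ∨ (y 0 = x 0 ∧ y 1 = x 1 + 1)) ∨
      ((x 0 = y 0 + 1 ∧ x 1 = y 1) ∨ (x 0 = y 0 ∧ x 1 = y 1 + 1)) := by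
  have h10 : (1 : Fin 2) ≠ 0 := by decide
  have h01 : (0 : Fin 2) ≠ 1 := by decide
  rw [zdGraph_adj_iff, Fin.exists_fin_two]
  simp only [site_two_eq_iff, Pi.add_apply, Pi.single_eq_same, Pi.single_eq_of_ne h10,
    Pi.single_eq_of_ne h01, add_zero]
  tauto

/-- Diagonal adjacency of `ℤ²` in coordinates. [folklore] -/
private theorem diagAdj_iff (x y : Site 2) :
    ((∃ s : Fin 2, y = x + diagVec s) ∨ ∃ s : Fin 2, x = y + diagVec s) ↔
      (y 0 = x 0 + 1 ∧ (y 1 = x 1 + 1 ∨ y 1 = x 1 + -1)) ∨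
        (x 0 = y 0 + 1 ∧ (x 1 = y 1 + 1 ∨ x 1 = y 1 + -1)) := by
  have h10 : (1 : Fin 2) ≠ 0 := by decide
  rw [Fin.exists_fin_two, Fin.exists_fin_two]
  simp only [site_two_eq_iff, Pi.add_apply, diagVec_apply_zero, diagVec_apply_one, if_neg h10]
  tauto

variable (f : PolySite (halfOpenRect q) ≃ Fin (q 0 + 1) ×ₗ Fin (q 1 + 1))
  (hf0 : ∀ a, (((ofLex (f a)).1 : ℕ) : ℤ) = ofLex a.1 0) (hf1 : ∀ a, (((ofLex (f a)).2 : ℕ) : ℤ) = ofLex a.1 1)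

include hf0 hf1

/-- **Box bonds are open-cluster bonds**: under the coordinate bijection `[0,q+1) ≃ Fin (q₀+1) ×ₗ Fin (q₁+1)`
the induced nearest-neighbour graph of the box is the open-cluster graph `rectBoxGraph (q₀+1) (q₁+1)` (the
nearest-neighbour bonds `⟨i, j⟩` of LeBlanc et al. (2015) eq. (1) inside an open cluster).
[cite: LeBlancEtAl2015, eq. (1)] -/
theorem rectBoxGraph_adj_iff_polyGraph_adj_rect (a b : PolySite (halfOpenRect q)) :
    (rectBoxGraph (q 0 + 1) (q 1 + 1)).Adj (f a) (f b) ↔ (polyGraph (halfOpenRect q)).Adj a b := by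
  rw [polyGraph_adj, zdGraph_two_adj_iff, ← hf0 a, ← hf0 b, ← hf1 a, ← hf1 b]
  simp only [rectBoxGraph, lineAdj, Fin.ext_iff]
  omega

/-- **Diagonal box bonds are the open-cluster diagonal bonds**: under the coordinate bijection the
diagonal adjacency `y = x ± (e₁ ± e₂)` of the box is `rectBoxDiagGraph (q₀+1) (q₁+1)` (the next-nearest-neighbour
bonds `⟨⟨i, j⟩⟩` of LeBlanc et al. (2015) eq. (1) inside an open cluster). [cite: LeBlancEtAl2015, eq. (1)] -/
theorem rectBoxDiagGraph_adj_iff_diagAdj_rect (a b : PolySite (halfOpenRect q)) :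
    (rectBoxDiagGraph (q 0 + 1) (q 1 + 1)).Adj (f a) (f b) ↔
      ((∃ s : Fin 2, ofLex b.1 = ofLex a.1 + diagVec s) ∨ ∃ s : Fin 2, ofLex a.1 = ofLex b.1 + diagVec s) := by
  rw [diagAdj_iff, ← hf0 a, ← hf0 b, ← hf1 a, ← hf1 b]
  simp only [rectBoxDiagGraph, lineAdj]
  omega

omit hf0 hf1

/-- Third-neighbour adjacency of `ℤ²` in coordinates. [folklore] -/
private theorem axial2Adj_two_iff (x y : Site 2) :
    ((∃ s : Fin 2, y = x + axial2Vec s) ∨ ∃ s : Fin 2, x = y + axial2Vec s) ↔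
      ((y 0 = x 0 + 2 ∧ y 1 = x 1) ∨ (y 0 = x 0 ∧ y 1 = x 1 + 2)) ∨
        ((x 0 = y 0 + 2 ∧ x 1 = y 1) ∨ (x 0 = y 0 ∧ x 1 = y 1 + 2)) := by
  have h10 : (1 : Fin 2) ≠ 0 := by decide
  have h01 : (0 : Fin 2) ≠ 1 := by decide
  rw [Fin.exists_fin_two, Fin.exists_fin_two]
  simp only [site_two_eq_iff, Pi.add_apply, axial2Vec_apply_self, axial2Vec_apply_of_ne h10, axial2Vec_apply_of_ne h01, add_zero]

include hf0 hf1 in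
/-- **Third-neighbour box bonds are the open-cluster third-neighbour bonds**: under the coordinate bijection the adjacency `y = x ± 2e_i` of the
rectangle is `rectBoxAxial2Graph (q₀+1) (q₁+1)`. [cite: PavariniEtAl2001, eq. (1)] -/
theorem rectBoxAxial2Graph_adj_iff_axial2Adj_rect (a b : PolySite (halfOpenRect q)) :
    (rectBoxAxial2Graph (q 0 + 1) (q 1 + 1)).Adj (f a) (f b) ↔
      ((∃ s : Fin 2, ofLex b.1 = ofLex a.1 + axial2Vec s) ∨ ∃ s : Fin 2, ofLex a.1 = ofLex b.1 + axial2Vec s) := by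
  rw [axial2Adj_two_iff, ← hf0 a, ← hf0 b, ← hf1 a, ← hf1 b]
  simp only [rectBoxAxial2Graph, line2Adj, Fin.ext_iff]
  omega

include hf0 hf1 in
/-- **THE OPEN-CLUSTER HAMILTONIAN RELABELLED ONTO THE BOX IS THE LOCAL HAMILTONIAN**: under the coordinate bijection
`f : [0,q+1) ≃ Fin (q₀+1) ×ₗ Fin (q₁+1)`, `Γ_{f⁻¹} (hubbardOpenBoxTT'T'' (q₀+1) (q₁+1) t t' t'' U) = Σ_{X ⊆ [0,q+1)} Φ^M(X)`.
[cite: PavariniEtAl2001, eq. (1)] [cite: LeBlancEtAl2015, eq. (1)] -/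
theorem relabel_symm_hubbardOpenBoxTT'T''_eq_localHamiltonian (t t' t'' U : ℝ) :
    relabel (Orb.mapEquiv f.symm) (hubbardOpenBoxTT'T'' (q 0 + 1) (q 1 + 1) t t' t'' U) =
      (hubbardTT'T''FermionInteraction t t' t'' U).localHamiltonian (halfOpenRect q) := by
  classical
  rw [hubbardTT'T''_localHamiltonian_eq_threeGraph t t' t'' U (halfOpenRect q) ((rectBoxDiagGraph (q 0 + 1) (q 1 + 1)).comap f)
      (fun a b => rectBoxDiagGraph_adj_iff_diagAdj_rect q f hf0 hf1 a b) ((rectBoxAxial2Graph (q 0 + 1) (q 1 + 1)).comap f)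
      (fun a b => rectBoxAxial2Graph_adj_iff_axial2Adj_rect q f hf0 hf1 a b),
    hubbardOpenBoxTT'T'', hubbardOpenBoxTT', map_add, map_add,
    relabel_hamiltonian (rectBoxGraph (q 0 + 1) (q 1 + 1)) (polyGraph (halfOpenRect q)) f.symm (fun x y => by
      rw [← rectBoxGraph_adj_iff_polyGraph_adj_rect q f hf0 hf1, Equiv.apply_symm_apply, Equiv.apply_symm_apply]) t U,
    relabel_hamiltonian (rectBoxDiagGraph (q 0 + 1) (q 1 + 1)) ((rectBoxDiagGraph (q 0 + 1) (q 1 + 1)).comap f) f.symm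
      (fun x y => by rw [SimpleGraph.comap_adj, Equiv.apply_symm_apply, Equiv.apply_symm_apply]) t' 0,
    relabel_hamiltonian (rectBoxAxial2Graph (q 0 + 1) (q 1 + 1)) ((rectBoxAxial2Graph (q 0 + 1) (q 1 + 1)).comap f) f.symm
      (fun x y => by rw [SimpleGraph.comap_adj, Equiv.apply_symm_apply, Equiv.apply_symm_apply]) t'' 0]

include hf0 hf1 in
/-- **Duality**: for every matrix `ρ` on the cluster Fock space, `tr(H^M_{[0,q+1)} · Γ_{f⁻¹} ρ) = tr(hubbardOpenBoxTT'T'' · ρ)` — the free-boundary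
box energy of the relabelled cluster state is the cluster Hamiltonian's expectation. [cite: PavariniEtAl2001, eq. (1)] -/
theorem trace_localHamiltonian_mul_relabel_symm (t t' t'' U : ℝ)
    (ρ : Matrix (Finset (Orb (Fin (q 0 + 1) ×ₗ Fin (q 1 + 1)))) (Finset (Orb (Fin (q 0 + 1) ×ₗ Fin (q 1 + 1)))) ℂ) :
    ((hubbardTT'T''FermionInteraction t t' t'' U).localHamiltonian (halfOpenRect q) * relabel (Orb.mapEquiv f.symm) ρ).trace =
      (hubbardOpenBoxTT'T'' (q 0 + 1) (q 1 + 1) t t' t'' U * ρ).trace := by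
  rw [← relabel_symm_hubbardOpenBoxTT'T''_eq_localHamiltonian q f hf0 hf1, ← map_mul, trace_relabel]

/-- The total number operator relabelled onto the box is the box's total number operator (duality for the filling).
[cite: Lieb1995] -/
theorem trace_totalNumber_mul_relabel_symm
    (ρ : Matrix (Finset (Orb (Fin (q 0 + 1) ×ₗ Fin (q 1 + 1)))) (Finset (Orb (Fin (q 0 + 1) ×ₗ Fin (q 1 + 1)))) ℂ) :
    ((totalNumber : FermionOp (halfOpenRect q)) * relabel (Orb.mapEquiv f.symm) ρ).trace = (totalNumber * ρ).trace := by
  rw [← relabel_mapEquiv_totalNumber f.symm, ← map_mul, trace_relabel]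

end Rect

/-! ### §5. Cluster vectors: the t″-exact open-cluster cap of object M from ONE unit `N`-particle vector -/

section ClusterVector

/-- The fundamental cell of `ℤ²` with side vector `q + 1` has `(q₀+1)(q₁+1)` points. [cite: ArakiMoriya2003, §4.1] -/
theorem card_cell_two (q : Fin 2 → ℕ) : Fintype.card (Cell q) = (q 0 + 1) * (q 1 + 1) := by
  rw [Fintype.card_pi, Fin.prod_univ_two, Fintype.card_fin, Fintype.card_fin]

/-- `tr(M · |x⟩⟨x|) = ⟨x, M x⟩`. [cite: NielsenChuang2010, §2.4.3 Box 2.6 eqs. (2.181)–(2.182)] -/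
private theorem trace_mul_vecMulVec_star {κ : Type*} [Fintype κ] (M : Matrix κ κ ℂ) (x : κ → ℂ) :
    (M * vecMulVec x (star x)).trace = star x ⬝ᵥ (M *ᵥ x) := by
  simp only [dotProduct, mulVec, Matrix.trace, Matrix.diag, Matrix.mul_apply, vecMulVec_apply, Pi.star_apply, Finset.mul_sum]
  refine Finset.sum_congr rfl fun i _ => Finset.sum_congr rfl fun j _ => ?_
  ring

/-- **An `N`-particle vector's projector is even**: `Θ |φ⟩⟨φ| Θ = |φ⟩⟨φ|` (both legs pick up `(−1)^N`). [cite: ArakiMoriya2003, §4.1 eq. (4.8)] -/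
theorem parityAut_vecMulVec_self_of_isNParticle {ι : Type*} [LinearOrder ι] [Fintype ι] {N : ℕ} {φ : Fock ι}
    (hφ : IsNParticle N φ) : parityAut (vecMulVec φ (star φ)) = vecMulVec φ (star φ) := by
  ext s u
  rw [parityAut_apply, parityOp, Matrix.mul_diagonal, Matrix.diagonal_mul, vecMulVec_apply, Pi.star_apply]
  by_cases hs : s.card = N
  · by_cases hu : u.card = N
    · rw [hs, hu]
      have h1 : ((-1 : ℂ) ^ N) * ((-1 : ℂ) ^ N) = 1 := by rw [← pow_add, ← two_mul, pow_mul, neg_one_sq, one_pow]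
      linear_combination (φ s * star (φ u)) * h1
    · rw [hφ u hu, star_zero, mul_zero, mul_zero, zero_mul]
  · rw [hφ s hs, zero_mul, mul_zero, zero_mul]

/-- **THE t″-EXACT OPEN-CLUSTER CAP OF OBJECT M FROM ONE CLUSTER VECTOR.** For every unit `N`-particle vector `φ` of the open
`(q₀+1) × (q₁+1)` cluster and every `R ≥ 2`, the translation-invariant variational energy density of the `t–t'–t''–U` Hubbard model of `ℤ²` at
filling `N/((q₀+1)(q₁+1))` satisfies `e^M ≤ Re⟨φ, hubbardOpenBoxTT'T'' φ⟩/((q₀+1)(q₁+1))` — every intra-cluster bond (nearest, diagonal,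
THIRD-neighbour) read exactly; the `t''` twin of `energyDensityTT'_le_re_expect_openBox` (there via tori for `energyDensityTT'`, here in infinite volume
for `tiGroundEnergyDensityAt`). [cite: Ruelle1969, §3.3] [cite: PavariniEtAl2001, eq. (1)] -/
theorem tiGroundEnergyDensityAt_hubbardTT'T''_le_rayleigh_openBox (q : Fin 2 → ℕ) (t t' t'' U : ℝ) {R : ℝ} (hR : 2 ≤ R) {N : ℕ}
    {φ : Fock (Orb (Fin (q 0 + 1) ×ₗ Fin (q 1 + 1)))} (hφN : IsNParticle N φ) (hφ1 : star φ ⬝ᵥ φ = 1) :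
    (hubbardTT'T''FermionInteraction t t' t'' U).tiGroundEnergyDensityAt R ((((q 0 + 1) * (q 1 + 1) : ℕ) : ℝ)⁻¹ * N) ≤
      (((q 0 + 1) * (q 1 + 1) : ℕ) : ℝ)⁻¹ * (star φ ⬝ᵥ (hubbardOpenBoxTT'T'' (q 0 + 1) (q 1 + 1) t t' t'' U *ᵥ φ)).re := by
  obtain ⟨f, hf0, hf1⟩ := exists_equiv_polySite_halfOpenRect_two q
  set P : Matrix (Finset (Orb (Fin (q 0 + 1) ×ₗ Fin (q 1 + 1)))) (Finset (Orb (Fin (q 0 + 1) ×ₗ Fin (q 1 + 1)))) ℂ :=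
    vecMulVec φ (star φ) with hP
  have hPev : parityAut P = P := parityAut_vecMulVec_self_of_isNParticle hφN
  have hPtr : P.trace = 1 := by rw [hP, trace_vecMulVec, dotProduct_comm, hφ1]
  set ρ₀ : FermionOp (halfOpenRect q) := relabel (Orb.mapEquiv f.symm) P with hρ₀
  have hev : parityAut ρ₀ = ρ₀ := by rw [hρ₀, ← relabel_parityAut, hPev]
  have hpsd : ρ₀.PosSemidef := posSemidef_relabel _ (posSemidef_vecMulVec_self_star φ)
  have htr : ρ₀.trace = 1 := by rw [hρ₀, trace_relabel, hPtr]
  have h := InfVolFermionState.tiGroundEnergyDensityAt_hubbardTT'T''_le_of_rectTilingState q ρ₀ hev hpsd htr t t' t'' U hR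
  have hN : ((totalNumber : FermionOp (halfOpenRect q)) * ρ₀).trace = N := by
    rw [hρ₀, trace_totalNumber_mul_relabel_symm, hP, trace_mul_vecMulVec_star, (LiebTwo.isNParticle_iff_totalNumber N φ).1 hφN,
      dotProduct_smul, hφ1, smul_eq_mul, mul_one]
  have hH : ((hubbardTT'T''FermionInteraction t t' t'' U).localHamiltonian (halfOpenRect q) * ρ₀).trace =
      star φ ⬝ᵥ (hubbardOpenBoxTT'T'' (q 0 + 1) (q 1 + 1) t t' t'' U *ᵥ φ) := by
    rw [hρ₀, trace_localHamiltonian_mul_relabel_symm q f hf0 hf1, hP, trace_mul_vecMulVec_star]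
  rw [card_cell_two, hN, hH, Complex.natCast_re] at h
  exact h

/-- **At `t'' = 0`**: the same cluster vector caps the `t–t'` variational density (`hubbardOpenBoxTT'`, range `R ≥ 2`) — the infinite-volume
twin of `energyDensityTT'_le_re_expect_openBox` for every `tiGroundEnergyDensityAt` consumer. [cite: Ruelle1969, §3.3] [cite: LeBlancEtAl2015, eq. (1)] -/
theorem tiGroundEnergyDensityAt_hubbardTT'T''_zero_le_rayleigh_openBox (q : Fin 2 → ℕ) (t t' U : ℝ) {R : ℝ} (hR : 2 ≤ R) {N : ℕ}
    {φ : Fock (Orb (Fin (q 0 + 1) ×ₗ Fin (q 1 + 1)))} (hφN : IsNParticle N φ) (hφ1 : star φ ⬝ᵥ φ = 1) :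
    (hubbardTT'T''FermionInteraction t t' 0 U).tiGroundEnergyDensityAt R ((((q 0 + 1) * (q 1 + 1) : ℕ) : ℝ)⁻¹ * N) ≤
      (((q 0 + 1) * (q 1 + 1) : ℕ) : ℝ)⁻¹ * (star φ ⬝ᵥ (hubbardOpenBoxTT' (q 0 + 1) (q 1 + 1) t t' U *ᵥ φ)).re := by
  have h := tiGroundEnergyDensityAt_hubbardTT'T''_le_rayleigh_openBox q t t' 0 U hR hφN hφ1
  rwa [hubbardOpenBoxTT'T''_zero] at h

/-! ### §6. Witness planes: one cluster vector with five form bounds caps object M on the whole `(t', t'', U ≥ 0)` space -/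

/-- The third-neighbour piece is linear in its amplitude: `hamiltonian G t'' 0 = t'' • hamiltonian G 1 0`. [cite: PavariniEtAl2001, eq. (1)] -/
theorem hamiltonian_hop_smul {Λ : Type*} [LinearOrder Λ] [Fintype Λ] (G : SimpleGraph Λ) [DecidableRel G.Adj] (t'' : ℝ) :
    hamiltonian G t'' 0 = (t'' : ℂ) • hamiltonian G 1 0 := by
  simp only [hamiltonian, Complex.ofReal_zero, zero_smul, add_zero, Complex.ofReal_one, one_smul, smul_neg, neg_smul]

/-- The real part of a cluster mean value of the `t–t'–t''` cluster Hamiltonian is affine in the amplitudes: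
`Re⟨φ, H^M_open(1,t',t'',U) φ⟩ = Re⟨φ, H_open(1,0,0) φ⟩ + t' Re⟨φ, H_open(0,1,0) φ⟩ + t'' Re⟨φ, T₃ φ⟩ + U Re⟨φ, H_open(0,0,1) φ⟩`
with `T₃ = hamiltonian (rectBoxAxial2Graph a b) 1 0`. [cite: PavariniEtAl2001, eq. (1)] [cite: LeBlancEtAl2015, eq. (1)] -/
theorem re_expect_hubbardOpenBoxTT'T''_eq (a b : ℕ) (t' t'' U : ℝ) (φ : Fock (Orb (Fin a ×ₗ Fin b))) :
    (star φ ⬝ᵥ (hubbardOpenBoxTT'T'' a b 1 t' t'' U *ᵥ φ)).re =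
      (star φ ⬝ᵥ (hubbardOpenBoxTT' a b 1 0 0 *ᵥ φ)).re +
        t' * (star φ ⬝ᵥ (hubbardOpenBoxTT' a b 0 1 0 *ᵥ φ)).re +
          t'' * (star φ ⬝ᵥ (hamiltonian (rectBoxAxial2Graph a b) 1 0 *ᵥ φ)).re +
            U * (star φ ⬝ᵥ (hubbardOpenBoxTT' a b 0 0 1 *ᵥ φ)).re := by
  rw [hubbardOpenBoxTT'T'', hamiltonian_hop_smul, add_mulVec, smul_mulVec, dotProduct_add, dotProduct_smul, smul_eq_mul,
    Complex.add_re, Complex.re_ofReal_mul, re_expect_hubbardOpenBoxTT'_eq]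
  ring

/-- **WITNESS PLANES FOR OBJECT M.** One unit `N`-particle vector `φ` of the open `(q₀+1) × (q₁+1)` cluster with form bounds
`Re⟨φ, H_open(1,0,0) φ⟩ ≤ E_K`, `Re⟨φ, H_open(0,±1,0) φ⟩ ≤ E_P / E_M` (diagonal, both signs), `±Re⟨φ, T₃ φ⟩ ≤ E₃P / E₃M` (third neighbour, both
signs) and `Re⟨φ, H_open(0,0,1) φ⟩ ≤ E_D` certifies, for EVERY real `t', t''` and EVERY `U ≥ 0`,
`e^M(1, t', t'', U; N/|C|) ≤ (E_K + max(t'E_P, −t'E_M) + max(t''E₃P, −t''E₃M) + U E_D)/|C|` (`R ≥ 2`) — the `t''`-exact twin of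
`energyDensityTT'_le_of_openBox_witness_planes`: the shape a kernel-checked cluster certificate discharges once for the whole coupling space.
[cite: Ruelle1969, §3.3] [cite: PavariniEtAl2001, eq. (1)] -/
theorem tiGroundEnergyDensityAt_hubbardTT'T''_le_of_openBox_witness_planes (q : Fin 2 → ℕ) {U : ℝ} (hU : 0 ≤ U) {R : ℝ} (hR : 2 ≤ R)
    {N : ℕ} {φ : Fock (Orb (Fin (q 0 + 1) ×ₗ Fin (q 1 + 1)))} (hφN : IsNParticle N φ) (hφ1 : star φ ⬝ᵥ φ = 1)
    {EK EP EM E₃P E₃M ED : ℝ}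
    (hK : (star φ ⬝ᵥ (hubbardOpenBoxTT' (q 0 + 1) (q 1 + 1) 1 0 0 *ᵥ φ)).re ≤ EK)
    (hP : (star φ ⬝ᵥ (hubbardOpenBoxTT' (q 0 + 1) (q 1 + 1) 0 1 0 *ᵥ φ)).re ≤ EP)
    (hM : (star φ ⬝ᵥ (hubbardOpenBoxTT' (q 0 + 1) (q 1 + 1) 0 (-1) 0 *ᵥ φ)).re ≤ EM)
    (h₃P : (star φ ⬝ᵥ (hamiltonian (rectBoxAxial2Graph (q 0 + 1) (q 1 + 1)) 1 0 *ᵥ φ)).re ≤ E₃P)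
    (h₃M : -(star φ ⬝ᵥ (hamiltonian (rectBoxAxial2Graph (q 0 + 1) (q 1 + 1)) 1 0 *ᵥ φ)).re ≤ E₃M)
    (hD : (star φ ⬝ᵥ (hubbardOpenBoxTT' (q 0 + 1) (q 1 + 1) 0 0 1 *ᵥ φ)).re ≤ ED) (t' t'' : ℝ) :
    (hubbardTT'T''FermionInteraction 1 t' t'' U).tiGroundEnergyDensityAt R ((((q 0 + 1) * (q 1 + 1) : ℕ) : ℝ)⁻¹ * N) ≤
      (((q 0 + 1) * (q 1 + 1) : ℕ) : ℝ)⁻¹ * (EK + max (t' * EP) (-t' * EM) + max (t'' * E₃P) (-t'' * E₃M) + U * ED) := by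
  refine (tiGroundEnergyDensityAt_hubbardTT'T''_le_rayleigh_openBox q 1 t' t'' U hR hφN hφ1).trans ?_
  refine mul_le_mul_of_nonneg_left ?_ (inv_nonneg.2 (Nat.cast_nonneg _))
  rw [re_expect_hubbardOpenBoxTT'T''_eq]
  set X := (star φ ⬝ᵥ (hubbardOpenBoxTT' (q 0 + 1) (q 1 + 1) 0 1 0 *ᵥ φ)).re with hX
  set Y := (star φ ⬝ᵥ (hamiltonian (rectBoxAxial2Graph (q 0 + 1) (q 1 + 1)) 1 0 *ᵥ φ)).re with hY
  have hnegX : -X ≤ EM := by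
    have h := hM
    rw [hubbardOpenBoxTT'_zero_neg_one_zero, neg_mulVec, dotProduct_neg, Complex.neg_re] at h
    exact h
  have hdiag : t' * X ≤ max (t' * EP) (-t' * EM) := by
    rcases le_or_gt 0 t' with ht | ht
    · exact (mul_le_mul_of_nonneg_left hP ht).trans (le_max_left _ _)
    · have : t' * X = (-t') * (-X) := by ring
      rw [this]
      exact (mul_le_mul_of_nonneg_left hnegX (by linarith)).trans (le_max_right _ _)
  have hax : t'' * Y ≤ max (t'' * E₃P) (-t'' * E₃M) := by
    rcases le_or_gt 0 t'' with ht | ht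
    · exact (mul_le_mul_of_nonneg_left h₃P ht).trans (le_max_left _ _)
    · have : t'' * Y = (-t'') * (-Y) := by ring
      rw [this]
      exact (mul_le_mul_of_nonneg_left h₃M (by linarith)).trans (le_max_right _ _)
  have hdocc : U * (star φ ⬝ᵥ (hubbardOpenBoxTT' (q 0 + 1) (q 1 + 1) 0 0 1 *ᵥ φ)).re ≤ U * ED :=
    mul_le_mul_of_nonneg_left hD hU
  linarith

end ClusterVector



end Literature.MathematicalPhysics.QuantumLattice

end
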